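import Summits.BirchSwinnertonDyer.Rank1Residual.X11b.Three.CornerResidual
import Summits.BirchSwinnertonDyer.Rank1Residual.X11b.Three.CornerSplitResidualDefs
import HarnessLib

/-!
# Class X11b at `p = 3` (team N8/O2 = cell `b2b-bsdres`, seat x11b3-p8, lead deal #5 (R5-3), S12):
# the (T4″)@3 CORNER ∧ SPLIT(3) — `BSD(E,3)` from the three typed corner inputs; the binder `hCs`

HONEST FRAMING (verbatim, cell `b2b-bsdres`, run/shared/lean/b2b/bsd-rank1-residual/): the goal of
the cell is to DELETE the COMBINATION-SHAPED residual classes for ALL analytic-rank `≤ 1` curves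
over `ℚ` — "full BSD formula for every rank `≤ 1` curve in class `C`" assembled STRICTLY from
published theorems — so that the rank-`≤ 1` remainder becomes exactly the CONSTRUCTION-SHAPED
classes, which are TYPED (missing-input Props), NOT attempted; this is not "finishing BSD".
Research route; nothing booked; NO label changes; census numbers are EVIDENCE (x11b3-p6's CORNER
CENSUS, two engines), never facts. THEOREMS ONLY (no definition, no named fact, no `sorry`); the
typed inputs `CornerStepLAt` / `CornerTwistAt` / `CornerUpperAt` and the per-binder anatomy are in
`CornerResidual.lean` (same seat).

## What this file does

* `missingLowerBoundAt_of_cornerStepLAt_of_cornerTwistAt` — WHOLE corner, sign-free: the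
  main-conjecture half `ord₃ #Ш(E)_an ≤ ord₃ #Ш(E)` from `CornerStepLAt W` (STEP L sans `Surj`) and
  `CornerTwistAt W` (the twist's `≤`-half) + PUBLISHED facts, at the odd-`d_K` Manin-good Heegner
  datum of `exists_oddHeegnerData` (Jetchev–Skinner–Wan §7.4.1 bookkeeping,
  `missingLowerBoundAt_of_indexLowerBoundAt`). Offered to x11b3-p3's S13 chain.
* **`missingPPartAt_of_corner_split`** (lead deal #5 (R5-3)'s name) and **`bsdp_of_corner_split`**:
  on `ClassX11b W 3 ∧ ¬ Surj W 3 ∧ split(3)` — where `3 ∣ c₃ = ord₃ Δ_min` ALWAYS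
  (`ClassX11b.dvd_and_not_ram_of_not_surj` + Kodaira–Néron, `three_dvd_tamagawaProduct_iff_shapes`),
  so the Tamagawa-sharp input is needed on EVERY split-corner pair — `CornerStepLAt W →
  CornerTwistAt W → CornerUpperAt W → Typed.MissingPPartAt W 3` / `BSDp W 3` from the PUBLISHED
  facts Gross–Zagier, Kolyvagin (finiteness), GZK, modularity, newform, Hoffstein–Luo, Mazur 1978
  Cor. 4.1, Poitou–Tate, local Euler characteristic. NO `Surj`, NO `Ram` anywhere.
* `hCs_of_cornerInputs` — VERBATIM the type of the binder `hCs` of x11b3-p3's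
  `Three.forall_bsdp_of_classRecord` (p252266), discharged from `∀ W`, the three inputs.
* §3 the GZ-currency bundle `CornerSplitResidualAt` (x11b3-p8 p253172, filed under deal #4 (R2)'s
  "ONE typed residual decl" before the deal #5 re-scope; NOT a binder of record): it FOLLOWS from the
  three inputs on the split corner (`cornerSplitResidualAt_of_cornerInputs`), it GIVES the missing
  `3`-part (`missingPPartAt_of_cornerSplitResidualAt`, any odd-Heegner-datum bookkeeping, image-free),
  and it is TIGHT — `BSD(E,3)` + the twists' rank-`0` `3`-parts give it back
  (`cornerSplitResidualAt_of_bsdp_of_twists`): the honesty certificate that S12's residual asks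
  nothing beyond `BSD₃(E)` and `BSD₃(E^{d_K})` at the Gross–Zagier level.
Census reach (EVIDENCE, CORNER-CENSUS §2/§4): 129 class-pairs (image 3Ns 76 / 3Nn 53;
`v₃(Δ) ∈ {3,…,21}`; 48 also carry a split `ℓ ≠ 3`), `Ram = 0` on 129/129, 0 TRUE-OPEN (per pair 47
proved / 82 literal at L0 R196.10). CONDITIONAL; nothing booked; X11 ∧ `r = 1` ∧ `p = 3` stays
CONSTRUCTION-SHAPED (R6.2); O2 OPEN.

References: [JetchevSkinnerWan2017] §7.4.1–7.4.2, Thm. 7.2.1; [Castella2018] Thm. 2.3, Thm. 3.2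
(shape); [HoffsteinLuo1997]; [Mazur1978] Cor. 4.1; [MilneADT2006] I 2.8, 4.10(b);
[SilvermanATAEC1994] Cor. IV.9.2(d); [Miller2011LMS] Def. 1.1.
-/

noncomputable section

open scoped Classical

open WeierstrassCurve NumberField IsDedekindDomain Field Literature.NumberTheory.EllipticCurves
  Rat.HeightOneSpectrum
  Literature.NumberTheory.DiophantineGeometry
  Literature.NumberTheory.EllipticCurves.GreenbergSelmer
  Literature.NumberTheory.EllipticCurves.ModularForms
  Literature.NumberTheory.EllipticCurves.Rank1Residual
  Literature.NumberTheory.EllipticCurves.Rank1Residual.Typed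
  Literature.NumberTheory.EllipticCurves.Wuthrich2014
  Literature.NumberTheory.EllipticCurves.BalakrishnanEtAl2019
  Literature.NumberTheory.EllipticCurves.Skinner2016
  Literature.NumberTheory.QuadraticFields.Quadratic
  Literature.NumberTheory.Automorphic
  Literature.NumberTheory.GaloisRepresentations Literature.NumberTheory.GaloisCohomology
  Summit.BirchSwinnertonDyer.Rank1Residual.X11b.AcSelmer
  Summit.BirchSwinnertonDyer.Rank1Residual.X11b.LocBridge

namespace Summit.BirchSwinnertonDyer.Rank1Residual.X11b.Three

/-! ### §1. The main-conjecture half on the whole corner (sign-free) -/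

/-- **The main-conjecture half `ord₃ #Ш(E)_an ≤ ord₃ #Ш(E)` on the (T4″)@3 corner — from
`CornerStepLAt W` and `CornerTwistAt W`, sign at `3` NOT used.** At the odd-`d_K` Manin-good Heegner
datum of the pair (`exists_oddHeegnerData`: Hoffstein–Luo field `hHL`, newform `hnf`, Mazur 1978
Cor. 4.1 `hMaz`, Néron scaling a theorem): STEP L there (`indexLowerBoundAt_of_cornerStepLAt`,
image-free control: Poitou–Tate `hPT`, local Euler characteristic `hEP`) + the twist's `≤`-half
(`pPartRankZero_of_cornerTwistAt`) + the transports ⇒ `Typed.MissingLowerBoundAt W 3`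
(multr1-p2's `missingLowerBoundAt_of_indexLowerBoundAt`, Jetchev–Skinner–Wan §7.4.1). PUBLISHED
binders `hGZ`, `hKo`, `hGZK`, `hmod`, `hnf`, `hHL`, `hMaz`, `hPT`, `hEP`; NO `Surj`, NO `Ram`.
CONDITIONAL on the two inputs; nothing booked. [cite: JetchevSkinnerWan2017, §7.4.1 (eq:shalowerK-1)–(eq:shalower), pp. 30–31]
[cite: HoffsteinLuo1997, Theorem (§1)] [cite: Mazur1978, Cor. 4.1] [cite: Miller2011LMS, Def. 1.1] -/
theorem missingLowerBoundAt_of_cornerStepLAt_of_cornerTwistAt [Fact (Nat.Prime 3)]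
    (hGZ : ∀ (N : ℕ) [NeZero N] (W : WeierstrassCurve ℚ) (K : Type) [Field K] [NumberField K],
      gross_zagier N W K)
    (hKo : ∀ (N : ℕ) [NeZero N] (W : WeierstrassCurve ℚ) (K : Type) [Field K] [NumberField K],
      kolyvagin N W K)
    (hGZK : rank_eq_analyticRank_of_analyticRank_le_one) (hmod : hasEntireLFunction_rat)
    (hnf : exists_isNewformOf) (hHL : HoffsteinLuo1997_exists_twist_L_one_ne_zero)
    (hMaz : mazur_not_dvd_maninConstant_of_odd)
    (hPT : ∀ (K : Type) [Field K] [NumberField K], poitouTate_sum_localTatePairing_eq_zero K)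
    (hEP : ∀ (K : Type) [Field K] [NumberField K] (v : HeightOneSpectrum (𝓞 K)),
      localEulerPoincareCharacteristic (v.adicCompletion K))
    (W : WeierstrassCurve ℚ) [W.IsElliptic] [W.IsGloballyMinimal] (hX : ClassX11b W 3)
    (hns : ¬ Surj W 3) (hSL : CornerStepLAt W) (hTw : CornerTwistAt W) :
    Typed.MissingLowerBoundAt W 3 := by
  have hNS : integral_neronScaling_of_isGloballyMinimal :=
    integral_neronScaling_of_isGloballyMinimal_holds
  obtain ⟨hr, hp2, hmult, hirr⟩ := id hX
  haveI : NeZero (W.conductorNorm ℤ) := ⟨(W.conductorNorm_pos_holds).ne'⟩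
  obtain ⟨K, _, _, Dt, H, ι, P, Wd, _, _, Cd, hK, hodd, hpd, hHN, hP, hc, hμ, hLt, hWd⟩ :=
    exists_oddHeegnerData hnf hHL hMaz hNS W 3 hr hp2 hmult hirr
  have htam : padicValNat 3 Wd.tamagawaProduct = padicValNat 3 W.tamagawaProduct :=
    X2.padicValNat_tamagawaProduct_twist_of_heegner_of_odd W 3 hp2 K hK hodd hpd hHN Cd hWd
  have hu : padicValRat 3 (Cd.u : ℚ) = 0 :=
    padicValRat_u_eq_zero_of_twist_minimal W 3 K hK hHN hmult Cd hWd
  obtain ⟨qd, hqd, hv⟩ :=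
    pPartRankZero_of_cornerTwistAt hmod hGZK W hX hns hTw K Wd Cd hK hodd hHN hLt hWd
  exact missingLowerBoundAt_of_indexLowerBoundAt W 3 (W.conductorNorm ℤ) K Dt H ι P (hGZ _ W K)
    (hKo _ W K) hGZK hmod hK hHN hP hp2 hc hμ hr hLt Wd Cd hWd hu htam ⟨qd, hqd, hv.ge⟩
    (fun _ ↦ indexLowerBoundAt_of_cornerStepLAt hGZ hKo hmod hPT hEP W hX hns hSL (W.conductorNorm ℤ)
      K Dt H ι P rfl hK hodd hHN hLt hP hc)

/-! ### §2. Corner ∧ split(3): both halves, `BSD(E,3)`, the binder `hCs` -/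

/-- **On corner ∧ split(3) the Tamagawa atom is ALWAYS hit: `3 ∣ ∏_ℓ c_ℓ(E)`** (`¬Surj ∧ (irr) ⇒
3 ∣ ord₃ Δ_min`, `ClassX11b.dvd_and_not_ram_of_not_surj`; split ⇒ `ShapeAlpha W`, `c₃ = ord₃ Δ_min`;
`three_dvd_tamagawaProduct_iff_shapes`). So the Tamagawa-sharp input `CornerUpperAt` is asked on
every one of the 129 split-corner pairs (census: `c₃ = v₃(Δ) ∈ {3, 6, …, 21}`).
[cite: SilvermanATAEC1994, Cor. IV.9.2(d) (PDF p. 340)] -/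
theorem three_dvd_tamagawaProduct_of_corner_split [Fact (Nat.Prime 3)] (W : WeierstrassCurve ℚ)
    [W.IsElliptic] [W.IsGloballyMinimal] (hX : ClassX11b W 3) (hns : ¬ Surj W 3)
    (hs : W.HasSplitMultiplicativeReductionAtPrime 3) : 3 ∣ W.tamagawaProduct :=
  (shapeAlpha_of_corner_split W hX hns hs).2.2

/-- **CORNER ∧ SPLIT(3): the missing `3`-part from the three typed corner inputs** (lead deal #5
(R5-3)) — `ClassX11b W 3 → ¬ Surj W 3 → split(3) → CornerStepLAt W → CornerTwistAt W → CornerUpperAt W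
→ Typed.MissingPPartAt W 3`, granted the PUBLISHED named facts Gross–Zagier, Kolyvagin (finiteness),
GZK, modularity, newform, Hoffstein–Luo, Mazur 1978 Cor. 4.1, Poitou–Tate, local Euler characteristic.
Lower half = `missingLowerBoundAt_of_cornerStepLAt_of_cornerTwistAt`; upper half =
`missingUpperBoundAt_of_cornerUpperAt` (`3 ∣ ∏c` by `three_dvd_tamagawaProduct_of_corner_split`). NO
`Surj`, NO `Ram`. Census reach (EVIDENCE): 129 class-pairs, 0 TRUE-OPEN. CONDITIONAL; nothing
booked; O2 OPEN. [cite: JetchevSkinnerWan2017, §7.4.1–7.4.2 (pp. 30–31)] [cite: Miller2011LMS, Def. 1.1] -/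
theorem missingPPartAt_of_corner_split [Fact (Nat.Prime 3)]
    (hGZ : ∀ (N : ℕ) [NeZero N] (W : WeierstrassCurve ℚ) (K : Type) [Field K] [NumberField K],
      gross_zagier N W K)
    (hKo : ∀ (N : ℕ) [NeZero N] (W : WeierstrassCurve ℚ) (K : Type) [Field K] [NumberField K],
      kolyvagin N W K)
    (hGZK : rank_eq_analyticRank_of_analyticRank_le_one) (hmod : hasEntireLFunction_rat)
    (hnf : exists_isNewformOf) (hHL : HoffsteinLuo1997_exists_twist_L_one_ne_zero)
    (hMaz : mazur_not_dvd_maninConstant_of_odd)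
    (hPT : ∀ (K : Type) [Field K] [NumberField K], poitouTate_sum_localTatePairing_eq_zero K)
    (hEP : ∀ (K : Type) [Field K] [NumberField K] (v : HeightOneSpectrum (𝓞 K)),
      localEulerPoincareCharacteristic (v.adicCompletion K))
    (W : WeierstrassCurve ℚ) [W.IsElliptic] [W.IsGloballyMinimal] (hX : ClassX11b W 3)
    (hns : ¬ Surj W 3) (hs : W.HasSplitMultiplicativeReductionAtPrime 3)
    (hSL : CornerStepLAt W) (hTw : CornerTwistAt W) (hU : CornerUpperAt W) :
    Typed.MissingPPartAt W 3 :=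
  Typed.missingPPartAt_of_lower_of_upper W 3
    (missingLowerBoundAt_of_cornerStepLAt_of_cornerTwistAt hGZ hKo hGZK hmod hnf hHL hMaz hPT hEP W
      hX hns hSL hTw)
    (missingUpperBoundAt_of_cornerUpperAt hGZ hKo hGZK hmod hnf hHL hMaz W hX hns
      (three_dvd_tamagawaProduct_of_corner_split W hX hns hs) hU hTw)

/-- **`BSD(E,3)` on the (T4″)@3 CORNER ∧ SPLIT(3) from the three typed corner inputs**:
`ClassX11b W 3 → ¬ Surj W 3 → split(3) → CornerStepLAt W → CornerTwistAt W → CornerUpperAt W →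
BSDp W 3` (GZK closes Miller's clauses (i)–(ii)). Census reach (EVIDENCE): 129 class-pairs, 0
TRUE-OPEN. CONDITIONAL; nothing booked; X11 ∧ `r = 1` ∧ `p = 3` stays CONSTRUCTION-SHAPED (R6.2).
[cite: JetchevSkinnerWan2017, §7.4.1–7.4.2 (pp. 30–31)] [cite: Miller2011LMS, §1 and Def. 1.1] -/
theorem bsdp_of_corner_split [Fact (Nat.Prime 3)]
    (hGZ : ∀ (N : ℕ) [NeZero N] (W : WeierstrassCurve ℚ) (K : Type) [Field K] [NumberField K],
      gross_zagier N W K)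
    (hKo : ∀ (N : ℕ) [NeZero N] (W : WeierstrassCurve ℚ) (K : Type) [Field K] [NumberField K],
      kolyvagin N W K)
    (hGZK : rank_eq_analyticRank_of_analyticRank_le_one) (hmod : hasEntireLFunction_rat)
    (hnf : exists_isNewformOf) (hHL : HoffsteinLuo1997_exists_twist_L_one_ne_zero)
    (hMaz : mazur_not_dvd_maninConstant_of_odd)
    (hPT : ∀ (K : Type) [Field K] [NumberField K], poitouTate_sum_localTatePairing_eq_zero K)
    (hEP : ∀ (K : Type) [Field K] [NumberField K] (v : HeightOneSpectrum (𝓞 K)),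
      localEulerPoincareCharacteristic (v.adicCompletion K))
    (W : WeierstrassCurve ℚ) [W.IsElliptic] [W.IsGloballyMinimal] (hX : ClassX11b W 3)
    (hns : ¬ Surj W 3) (hs : W.HasSplitMultiplicativeReductionAtPrime 3)
    (hSL : CornerStepLAt W) (hTw : CornerTwistAt W) (hU : CornerUpperAt W) : BSDp W 3 :=
  Typed.bsdp_of_missingPPartAt W 3 hGZK (by rw [hX.1])
    (missingPPartAt_of_corner_split hGZ hKo hGZK hmod hnf hHL hMaz hPT hEP W hX hns hs hSL hTw hU)

/-- **The binder `hCs` of `Three.forall_bsdp_of_classRecord` (x11b3-p3, p252266) DISCHARGED from the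
three typed corner inputs `∀ W`** — verbatim its type `ClassX11b W 3 → ¬ Surj W 3 →
3 ∣ ord₃ Δ_min → ¬ Ram W 3 → split(3) → Typed.MissingPPartAt W 3` (the two middle antecedents follow
from the first two and are unused). For S13's CLASS RECORD v4.1 append. CONDITIONAL; nothing booked.
[cite: Miller2011LMS, Def. 1.1] -/
theorem hCs_of_cornerInputs [Fact (Nat.Prime 3)]
    (hGZ : ∀ (N : ℕ) [NeZero N] (W : WeierstrassCurve ℚ) (K : Type) [Field K] [NumberField K],
      gross_zagier N W K)
    (hKo : ∀ (N : ℕ) [NeZero N] (W : WeierstrassCurve ℚ) (K : Type) [Field K] [NumberField K],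
      kolyvagin N W K)
    (hGZK : rank_eq_analyticRank_of_analyticRank_le_one) (hmod : hasEntireLFunction_rat)
    (hnf : exists_isNewformOf) (hHL : HoffsteinLuo1997_exists_twist_L_one_ne_zero)
    (hMaz : mazur_not_dvd_maninConstant_of_odd)
    (hPT : ∀ (K : Type) [Field K] [NumberField K], poitouTate_sum_localTatePairing_eq_zero K)
    (hEP : ∀ (K : Type) [Field K] [NumberField K] (v : HeightOneSpectrum (𝓞 K)),
      localEulerPoincareCharacteristic (v.adicCompletion K))
    (hSL : ∀ (W : WeierstrassCurve ℚ) [W.IsElliptic] [W.IsGloballyMinimal], CornerStepLAt W)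
    (hTw : ∀ (W : WeierstrassCurve ℚ) [W.IsElliptic] [W.IsGloballyMinimal], CornerTwistAt W)
    (hU : ∀ (W : WeierstrassCurve ℚ) [W.IsElliptic] [W.IsGloballyMinimal], CornerUpperAt W) :
    ∀ (W : WeierstrassCurve ℚ) [W.IsElliptic] [W.IsGloballyMinimal],
      ClassX11b W 3 → ¬ Surj W 3 → 3 ∣ padicValInt 3 W.minimalDiscriminantInt → ¬ Ram W 3 →
        W.HasSplitMultiplicativeReductionAtPrime 3 → Typed.MissingPPartAt W 3 :=
  fun W _ _ hX hns _ _ hs ↦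
    missingPPartAt_of_corner_split hGZ hKo hGZK hmod hnf hHL hMaz hPT hEP W hX hns hs (hSL W) (hTw W)
      (hU W)

/-! ### §3. The GZ-currency bundle `CornerSplitResidualAt` (p253172): from the inputs, to `BSD`, and tight -/

/-- **The three corner inputs give the GZ-currency bundle on the split corner**:
`CornerStepLAt W → CornerTwistAt W → CornerUpperAt W → CornerSplitResidualAt W` (at each odd Heegner
datum: (R-L) by `indexLowerBoundAt_of_cornerStepLAt`, (R-U♯) = `CornerUpperAt` there since
`3 ∣ ∏c` on the split corner, (R-Tw) by `pPartRankZero_of_cornerTwistAt`). PUBLISHED binders `hGZ`,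
`hKo`, `hGZK`, `hmod`, `hPT`, `hEP`. Bookkeeping. [cite: JetchevSkinnerWan2017, §7.4.1 (p. 30)]
[cite: Miller2011LMS, Def. 1.1] -/
theorem cornerSplitResidualAt_of_cornerInputs [Fact (Nat.Prime 3)]
    (hGZ : ∀ (N : ℕ) [NeZero N] (W : WeierstrassCurve ℚ) (K : Type) [Field K] [NumberField K],
      gross_zagier N W K)
    (hKo : ∀ (N : ℕ) [NeZero N] (W : WeierstrassCurve ℚ) (K : Type) [Field K] [NumberField K],
      kolyvagin N W K)
    (hGZK : rank_eq_analyticRank_of_analyticRank_le_one) (hmod : hasEntireLFunction_rat)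
    (hPT : ∀ (K : Type) [Field K] [NumberField K], poitouTate_sum_localTatePairing_eq_zero K)
    (hEP : ∀ (K : Type) [Field K] [NumberField K] (v : HeightOneSpectrum (𝓞 K)),
      localEulerPoincareCharacteristic (v.adicCompletion K))
    (W : WeierstrassCurve ℚ) [W.IsElliptic] [W.IsGloballyMinimal]
    (hSL : CornerStepLAt W) (hTw : CornerTwistAt W) (hU : CornerUpperAt W) :
    CornerSplitResidualAt W := by
  intro hX hns hs N _ K _ _ Dt H ι P Wd _ _ Cd hN hK hodd hHN hLt hP hc hPinf hfin hWd
  have ht : 3 ∣ W.tamagawaProduct := three_dvd_tamagawaProduct_of_corner_split W hX hns hs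
  refine ⟨indexLowerBoundAt_of_cornerStepLAt hGZ hKo hmod hPT hEP W hX hns hSL N K Dt H ι P hN hK hodd
      hHN hLt hP hc, hU N K Dt H ι P hX hns ht hN hK hodd hHN hLt hP hc hPinf hfin, ?_⟩
  subst hN
  exact pPartRankZero_of_cornerTwistAt hmod hGZK W hX hns hTw K Wd Cd hK hodd hHN hLt hWd

/-- **The GZ-currency bundle delivers the missing `3`-part** — `ClassX11b W 3 → ¬ Surj W 3 → split(3)
→ CornerSplitResidualAt W → Typed.MissingPPartAt W 3`, from the PUBLISHED facts Gross–Zagier,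
Kolyvagin (finiteness), GZK, modularity, newform, Hoffstein–Luo, Mazur 1978 Cor. 4.1: instantiate the
bundle at the datum of `exists_oddHeegnerData` (`Ш(E/K)` finite and `P ∉ E(K)_tors` by Gross–Zagier +
Kolyvagin there) and run both halves (`missingLowerBoundAt_of_indexLowerBoundAt`;
`missingUpperBoundAt_of_shaIndexBound_sharp` with `w = ord₃ ∏c_ℓ(E)`; transports are theorems). NO
`Surj`, NO `Ram`, no S0-level input (weaker hypotheses than `missingPPartAt_of_corner_split`).
CONDITIONAL on the bundle; nothing booked. [cite: JetchevSkinnerWan2017, §7.4.1–7.4.2 (pp. 30–31)]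
[cite: HoffsteinLuo1997, Theorem (§1)] [cite: Mazur1978, Cor. 4.1] [cite: Miller2011LMS, Def. 1.1] -/
theorem missingPPartAt_of_cornerSplitResidualAt [Fact (Nat.Prime 3)]
    (hGZ : ∀ (N : ℕ) [NeZero N] (W : WeierstrassCurve ℚ) (K : Type) [Field K] [NumberField K],
      gross_zagier N W K)
    (hKo : ∀ (N : ℕ) [NeZero N] (W : WeierstrassCurve ℚ) (K : Type) [Field K] [NumberField K],
      kolyvagin N W K)
    (hGZK : rank_eq_analyticRank_of_analyticRank_le_one) (hmod : hasEntireLFunction_rat)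
    (hnf : exists_isNewformOf) (hHL : HoffsteinLuo1997_exists_twist_L_one_ne_zero)
    (hMaz : mazur_not_dvd_maninConstant_of_odd)
    (W : WeierstrassCurve ℚ) [W.IsElliptic] [W.IsGloballyMinimal] (hX : ClassX11b W 3)
    (hns : ¬ Surj W 3) (hs : W.HasSplitMultiplicativeReductionAtPrime 3)
    (hR : CornerSplitResidualAt W) : Typed.MissingPPartAt W 3 := by
  have hNS : integral_neronScaling_of_isGloballyMinimal :=
    integral_neronScaling_of_isGloballyMinimal_holds
  obtain ⟨hr, hp2, hmult, hirr⟩ := id hX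
  haveI : NeZero (W.conductorNorm ℤ) := ⟨(W.conductorNorm_pos_holds).ne'⟩
  obtain ⟨K, _, _, Dt, H, ι, P, Wd, _, _, Cd, hK, hodd, hpd, hHN, hP, hc, hμ, hLt, hWd⟩ :=
    exists_oddHeegnerData hnf hHL hMaz hNS W 3 hr hp2 hmult hirr
  have hPinf : ¬ IsOfFinAddOrder P :=
    not_isOfFinAddOrder_of_heegner_of_analyticRank_eq_one W _ K Dt H ι P (hGZ _ W K) hmod hr hK hHN
      hLt hP
  have hfinK : Finite (W.baseChange K).sha :=
    finite_sha_baseChange_of_heegner W _ K Dt H ι P (hGZ _ W K) (hKo _ W K) hmod hr hK hHN hLt hP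
  obtain ⟨hL, hU, htw⟩ :=
    hR hX hns hs (W.conductorNorm ℤ) K Dt H ι P Wd Cd rfl hK hodd hHN hLt hP hc hPinf hfinK hWd
  have htam : padicValNat 3 Wd.tamagawaProduct = padicValNat 3 W.tamagawaProduct :=
    X2.padicValNat_tamagawaProduct_twist_of_heegner_of_odd W 3 hp2 K hK hodd hpd hHN Cd hWd
  have hu : padicValRat 3 (Cd.u : ℚ) = 0 :=
    padicValRat_u_eq_zero_of_twist_minimal W 3 K hK hHN hmult Cd hWd
  obtain ⟨qd, hqd, hv⟩ := htw
  refine Typed.missingPPartAt_of_lower_of_upper W 3 ?_ ?_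
  · exact missingLowerBoundAt_of_indexLowerBoundAt W 3 (W.conductorNorm ℤ) K Dt H ι P (hGZ _ W K)
      (hKo _ W K) hGZK hmod hK hHN hP hp2 hc hμ hr hLt Wd Cd hWd hu htam ⟨qd, hqd, hv.ge⟩ (fun _ ↦ hL)
  · exact missingUpperBoundAt_of_shaIndexBound_sharp W 3 (W.conductorNorm ℤ) K Dt H ι P (hGZ _ W K)
      (hKo _ W K) hGZK hmod hK hHN hP hp2 hc hμ hr hLt Wd Cd hWd hu htam le_rfl ⟨qd, hqd, hv.le⟩
      (fun _ _ ↦ hU)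

/-- **TIGHTNESS of the GZ-currency bundle: `BSD(E,3)` and the rank-`0` print shapes of the Heegner
twists give `CornerSplitResidualAt W` back** (so S12's residual asks NOTHING beyond the
Birch–Swinnerton-Dyer `3`-parts of `E` and of its twists `E^{(d_K)}` at the Gross–Zagier level; compare
S1's `openInputOnTreeAt_iff_bsdp_of_locus`). Granted Gross–Zagier, Kolyvagin (finiteness), GZK,
modularity: from `BSDp W 3` (`ord₃ #Ш(E)_an = ord₃ #Ш(E)`) and `PPartRankZero Wd 3` for the twists,
the Gross–Zagier core `exists_shaAn_padicVal_eq_of_heegner` (`ord₃ q + ord₃ q_d + ord₃ ∏c(E) +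
2·ord₃ #E^d(ℚ)_tors = 2·ord₃ [E(K):ℤP]`, `ord₃ #Ш(E/K) = ord₃ #Ш(E) + ord₃ #Ш(E^d)`) and the transports
give the Heegner-index IDENTITY over `K`, i.e. (R-L) ∧ (R-U♯). Bookkeeping.
[cite: JetchevSkinnerWan2017, §7.4.1 (eq:gz for K′) and §7.3.1 (eq:tamK), pp. 29–30]
[cite: GrossLMS1991, §2 Conj. (2.2)] [cite: Miller2011LMS, Def. 1.1] -/
theorem cornerSplitResidualAt_of_bsdp_of_twists [Fact (Nat.Prime 3)]
    (hGZ : ∀ (N : ℕ) [NeZero N] (W : WeierstrassCurve ℚ) (K : Type) [Field K] [NumberField K],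
      gross_zagier N W K)
    (hKo : ∀ (N : ℕ) [NeZero N] (W : WeierstrassCurve ℚ) (K : Type) [Field K] [NumberField K],
      kolyvagin N W K)
    (hGZK : rank_eq_analyticRank_of_analyticRank_le_one) (hmod : hasEntireLFunction_rat)
    (W : WeierstrassCurve ℚ) [W.IsElliptic] [W.IsGloballyMinimal] (hbsd : BSDp W 3)
    (htw : ∀ (K : Type) [Field K] [NumberField K]
      (Wd : WeierstrassCurve ℚ) [Wd.IsElliptic] [Wd.IsGloballyMinimal] (Cd : VariableChange ℚ),
      IsImaginaryQuadratic K → Odd (NumberField.discr K) →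
      SatisfiesHeegnerHypothesis (W.conductorNorm ℤ) K →
      (W.quadraticTwist (NumberField.discr K : ℚ)).entireLFunction 1 ≠ 0 →
      Cd • W.quadraticTwist (NumberField.discr K : ℚ) = Wd → PPartRankZero Wd 3) :
    CornerSplitResidualAt W := by
  intro hX _hns _hs N _ K _ _ Dt H ι P Wd _ _ Cd hN hK hodd hHN hLt hP hc _hPinf _hfin hWd
  obtain ⟨hr, hp2, hmult, -⟩ := id hX
  subst hN
  have h3N : 3 ∣ W.conductorNorm ℤ := dvd_conductorNorm_of_classX11b hX
  obtain ⟨hpd, hμ⟩ :=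
    not_dvd_discr_and_not_dvd_torsionOrder_of_heegner hK hHN (p := 3) (by decide) h3N
  have htam : padicValNat 3 Wd.tamagawaProduct = padicValNat 3 W.tamagawaProduct :=
    X2.padicValNat_tamagawaProduct_twist_of_heegner_of_odd W 3 hp2 K hK hodd hpd hHN Cd hWd
  have hu : padicValRat 3 (Cd.u : ℚ) = 0 :=
    padicValRat_u_eq_zero_of_twist_minimal W 3 K hK hHN hmult Cd hWd
  have htwd : PPartRankZero Wd 3 := htw K Wd Cd hK hodd hHN hLt hWd
  obtain ⟨qd, hqd, hvd⟩ := htwd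
  obtain ⟨hfinW, -, hsha, q, hq, hval⟩ := exists_shaAn_padicVal_eq_of_heegner W 3 _ K Dt H ι P
    (hGZ _ W K) (hKo _ W K) hGZK hmod hK hHN hP hp2 hc hμ hr hLt Wd Cd hWd hu qd hqd
  -- `BSD(E,3)`: `ord₃ q = ord₃ #Ш(E)` (the rational `q` with `shaAn W = q` is unique)
  haveI : Finite W.sha := hfinW
  obtain ⟨q', hq', hv'⟩ := Typed.missingPPartAt_of_bsdp W 3 hbsd
  have hqq : q' = q := by exact_mod_cast hq'.symm.trans hq
  rw [hqq] at hv'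
  have e1 : (2 * padicValNat 3 (AddSubgroup.zmultiples P).index : ℤ) =
      padicValRat 3 q + padicValRat 3 qd + padicValNat 3 W.tamagawaProduct +
        2 * padicValNat 3 Wd.torsionOrder := by exact_mod_cast hval.symm
  have e2 : (padicValNat 3 (W.baseChange K).shaOrder : ℤ) =
      padicValNat 3 W.shaOrder + padicValNat 3 Wd.shaOrder := by exact_mod_cast hsha
  have e3 : (padicValNat 3 Wd.tamagawaProduct : ℤ) = padicValNat 3 W.tamagawaProduct := by
    exact_mod_cast htam
  refine ⟨?_, ?_, ⟨qd, hqd, hvd⟩⟩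
  · unfold IndexLowerBoundAt
    omega
  · omega


end Summit.BirchSwinnertonDyer.Rank1Residual.X11b.Three

end
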